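import Literature.Barriers.AtomisticToContinuum.SutoDegenerateGroundStatesProofs
import Literature.Analysis.Distribution.FourierSupportAtZero
import HarnessLib

/-!
# Narrowed barrier `SutoDegenerateGroundStatesNarrow` (barrier audit of `SutoDegenerateGroundStates`, 2026-08-15)

`Literature/Barriers/AtomisticToContinuum/` (D-0021 barrier catalogue), sub-problem
`Crystallization`. Companion of `SutoDegenerateGroundStates.lean` (A. Sütő, Phys. Rev. Lett. 95
(2005) 265501 and Phys. Rev. B 74 (2006) 104117, THEOREM (i): for a Fourier-positive,
band-limited, strongly tempered pair interaction `φ = Re 𝓕⁻ψ` on `ℝᵈ`, every finite disjoint union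
of periodic configurations whose lattices satisfy `q_{B_j^*} ≥ K₀` is an infinite-volume ground
state configuration; entry `SutoDegenerateGroundStates`, DISCHARGED in
`SutoDegenerateGroundStatesProofs.lean` as `SutoDegenerateGroundStates_holds`) — so the typed
statement is a theorem and cannot be refuted; this audit is about what it BLOCKS.

**Audit (refuter, 2026-08-15).** Re-read at page level (arXiv versions, materialised): Sütő 2005,
pp. 1–5 (abstract; Definitions; the observation before the THEOREM; THEOREM (i)–(iii); the
paragraph after it on `e_ρ`, `e_μ`, stability/superstability and the breakdown of `μ ↦ ρ` "for
small densities"; Examples; LEMMA; proofs of (i)–(iii)); Sütő 2006, §2 pp. 5–8 (Definition,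
THEOREM (i)–(iii), Remarks 1–7) and §3.3; Sütő 2011, abstract and the sections on GSCs and
infinite-density ground states in infinite space (Lemma 10, Conjecture 1 and the paragraph after it); Zhang–Stillinger–Torquato 2015 (stacked-slider phases),
§1 and §4 (Stealthy Stacking Theorem); Blanc–Lewin 2015, §1.3 and §2.1. Verdict: NARROWED. The
parent's BARRIER block says the theorem blocks "the natural strengthening of
`AtomisticToContinuum/Crystallization` from Lennard-Jones to a potential-generic statement 'ground
states of stable, smooth, fast-decaying pair interactions in `ℝ³` are periodic (crystalline) and
essentially unique'". But `Crystallization` is a ZERO-PRESSURE problem (`E(N)`: `N` particles in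
all of `ℝ³`, density free, energy PER PARTICLE minimised), while Sütő's degeneracy is a
PRESCRIBED-DENSITY (or prescribed-`μ`) phenomenon, and the two regimes meet only on the
non-superstable edge of the class:

1. THE FAMILY'S ENERGY PER PARTICLE IS AFFINE IN THE DENSITY (clause (2), proved). The field of a
   member `X` is force-free, `U(r|X) = ρ(X)φ̂(0)` [SutoPRL2005, end of proof of (i)], so at every
   site the energy per particle is `½[ρ(X)φ̂(0) − φ(0)] = ε(ρ)/ρ` with
   `ε(ρ) = ½ρ[ρφ̂(0) − φ(0)]` [Suto2006, THEOREM (i)] — it depends on the member only through its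
   density, non-decreasingly.
2. SUPERSTABLE MEMBERS (`φ̂(0) > 0`): ZERO PRESSURE SEES NO DEGENERACY. The energy per particle is
   then STRICTLY increasing in `ρ` (`Suto.siteEnergy_lt_siteEnergy`): no member of density
   `> ρ_d` — i.e. no degenerate one — minimises it even among the members, and the family's unique
   minimiser sits at the threshold `ρ_d`, where `q_{B^*} = K₀` holds "for a unique Bravais lattice
   `B`, and this is the unique periodic GSC … the bcc one" [Suto2006, Remark 2; SutoPRL2005,
   THEOREM (ii)]. Whether bcc at `ρ₃` or some configuration of density `< ρ₃` (where "our results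
   [are] not predictive" [SutoPRL2005, introduction]) is the zero-pressure ground state is open;
   either way the theorem offers no degenerate competitor, and the crystallization review, which
   formulates exactly this problem, never cites it ("no generic class of potentials has been
   identified, for which crystallization can be proved" [BlancLewin2015, §2.1]).
3. NON-SUPERSTABLE EDGE (`φ̂(0) = 0`, "even if `φ̂(0) = 0` and thus `φ` is not superstable"
   [Suto2006, Remark 4]): ZERO PRESSURE IS TOTALLY DEGENERATE. The energy per particle is
   `≡ −φ(0)/2` on the whole family (all densities `≥ ρ_d`, aperiodic unions at `≥ 2ρ_d` included)
   and `U(R) ≥ −N_R φ(0)/2` for every finite `R` (clause (1), proved; [SutoPRL2005, before the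
   THEOREM]) — every member is a zero-pressure ground state of one stable, smooth, Schwartz-decaying
   radial pair potential (`Suto.annulusProfile`, certified admissible with `φ(0) > 0`). So the
   parent's `blocks:` sentence is literally right for merely STABLE potentials, and wrong as soon
   as SUPERSTABILITY (automatic for Lennard-Jones-type cores, `∫V = +∞`) is among the hypotheses.
4. PRESCRIBED DENSITY / CHEMICAL POTENTIAL: the barrier is robust and even wider than printed in
   the parent — uniqueness up to isometry fails at every `ρ > ρ_d` [SutoPRL2005, abstract;
   Suto2006, Remark 2], lattice-periodicity fails from `2ρ_d` by incommensurate unions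
   [Suto2006, Remark 2] and already between `ρ_d` and `2ρ_d` (from `ρ_sh = √(3/2)ρ₃`, our
   evaluation of their `χ` formula) by stacked-slider configurations
   [ZhangStillingerTorquato2015, §4]; at zero chemical potential ("globally stable",
   [Suto2006, Remark 5]) the same holds whenever `φ(0)/2φ̂(0) > ρ_d` [SutoPRL2005, Examples].
5. ENERGY VALUES ARE NEVER MISSED: `ε(ρ)` is attained by a Bravais lattice at every `ρ ≥ ρ_d`
   [Suto2006, THEOREM (i)–(ii)], so `HasPeriodicGroundStateEnergy`-type statements are
   untouched; only "every ground state is periodic / unique" is blocked.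
6. NON-VACUITY OF THE CLASS, certified: the parent's `Suto.IsAdmissible` had only the inhabitant
   `ψ = 0` inside Lean; here `Suto.isAdmissible_plateauProfile` (`φ̂(0) = 1`, superstable type)
   and `Suto.isAdmissible_annulusProfile` (`φ̂(0) = 0`, `φ(0) > 0`, the edge), in every dimension,
   with strong temperedness from the Schwartz decay of `𝓕⁻ψ` (tree: `plateauSchwartz`,
   `exists_norm_le_one_add_norm_pow_neg`; Mathlib: `HasCompactSupport.toSchwartzMap`). The
   parent's technique_class phrase "hypotheses … that hold throughout `Suto.IsAdmissible`" must
   accordingly be read "met by some non-zero admissible `ψ`".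

Contents: `Suto.potential_zero` (`φ(0) = ∫ψ`), `Suto.neg_half_mul_le_energy` (clause (1)),
`Suto.density`, `Suto.hasSum_potential_iUnion_diff_singleton` (clause (2)), the two inhabitants
and their admissibility, the entry `SutoDegenerateGroundStatesNarrow` with its BARRIER block,
proved (`sutoDegenerateGroundStatesNarrow_holds`, axioms `propext`, `Classical.choice`,
`Quot.sound`), and the corollaries `Suto.siteEnergy_eq`, `Suto.siteEnergy_lt_siteEnergy`
(superstable: strictly increasing), `Suto.siteEnergy_eq_neg_half` (edge: constant `−φ(0)/2`, not
undercut by any finite configuration), `Suto.exists_admissible_not_superstable`,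
`Suto.exists_admissible_superstable`. No new `def … : Prop` besides the entry (D-0026).

## References (read at the cited places)

* [SutoPRL2005] A. Sütő, *Crystalline ground states for classical particles*, Phys. Rev. Lett.
  95 (2005) 265501, arXiv:math-ph/0508004: abstract, introduction, Definitions and notations,
  THEOREM (i)–(iii) and the paragraph after it, Examples, proof of (i)–(ii) (pp. 1–5).
* [Suto2006] A. Sütő, *From bcc to fcc: interplay between oscillating long-range and repulsive
  short-range forces*, Phys. Rev. B 74 (2006) 104117, arXiv:math-ph/0608041: §2 Definition,
  THEOREM (i)–(iii), Remarks 1–7 (pp. 5–8), §3.3 (p. 10).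
* [Suto2011] A. Sütő, *Ground state at high density*, Comm. Math. Phys. 305 (2011) 657–710,
  arXiv:1004.5260: abstract; sections "Ground state configurations in infinite space"
  (Lemma 10) and "Infinite-density ground state in infinite space" (Conjecture 1 and the
  paragraph after it), pp. 13–16 of the arXiv version.
* [ZhangStillingerTorquato2015] G. Zhang, F. H. Stillinger, S. Torquato, *Ground states of
  stealthy hyperuniform potentials. II. Stacked-slider phases*, Phys. Rev. E 92 (2015) 022120,
  arXiv:1508.04728: §1, §4 (Stealthy Stacking Theorem and the `d = 3` examples).
* [BlancLewin2015] X. Blanc, M. Lewin, *The crystallization conjecture: a review*, EMS Surv.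
  Math. Sci. 2 (2015) 255–306, arXiv:1504.01153: §1.3 (`e_∞`, stability via `V̂₂ ≥ 0`), §2.1
  ("no generic class of potentials has been identified").
* [FlatleyTheil2015] L. Flatley, F. Theil, ARMA 218 (2015), §1 and Theorem 1.1 (as in the parent;
  not re-read beyond §1).
-/

noncomputable section

open scoped RealInnerProductSpace FourierTransform
open MeasureTheory Complex Set Literature.MathematicalPhysics.StatisticalMechanics
  Literature.Algebra.EuclideanLattices

namespace Literature.Barriers.AtomisticToContinuum

namespace Suto

variable {d : ℕ} {κ : ℝ} {ψ : EuclideanSpace ℝ (Fin d) → ℝ}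

/-! ### `φ(0) = ∫ ψ` and the universal lower bound `U(R) ≥ −N φ(0)/2` -/

/-- `φ(0) = ∫ ψ = (2π)^{-d} ∫ φ̂`. [cite: Suto2006, §2 THEOREM (i)] -/
theorem potential_zero : potential ψ 0 = ∫ w, ψ w := by
  rw [potential, Real.fourierInv_eq']
  simp only [inner_zero_right, mul_zero, Complex.ofReal_zero, zero_mul, Complex.exp_zero,
    one_smul]
  rw [integral_complex_ofReal, Complex.ofReal_re]

/-- `φ(0) ≥ 0` for `ψ ≥ 0`. [folklore] -/
theorem potential_zero_nonneg (h : ∀ w, 0 ≤ ψ w) : 0 ≤ potential ψ 0 := by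
  rw [potential_zero]
  exact integral_nonneg h

/-- `U(R) = ½(∑_{i,j} φ(r_i − r_j) − N φ(0))` (the diagonal added back). [cite: Suto2006, §3.3] -/
theorem energy_eq_half_sum_sub (φ : EuclideanSpace ℝ (Fin d) → ℝ) {N : ℕ}
    (R : Fin N → EuclideanSpace ℝ (Fin d)) :
    energy φ R = 1 / 2 * (∑ i, ∑ j, φ (R i - R j) - N * φ 0) := by
  have hfilter : ∀ i : Fin N, (Finset.univ.filter fun j => j ≠ i) = Finset.univ.erase i := by
    intro i
    ext j
    simp [Finset.mem_erase]
  have hin : ∀ i, ∑ j ∈ Finset.univ.filter (fun j => j ≠ i), φ (R i - R j) =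
      ∑ j, φ (R i - R j) - φ 0 := by
    intro i
    rw [hfilter, Finset.sum_erase_eq_sub (Finset.mem_univ i), sub_self]
  unfold energy
  rw [Finset.sum_congr rfl fun i _ => hin i, Finset.sum_sub_distrib, Finset.sum_const,
    Finset.card_univ, Fintype.card_fin, nsmul_eq_mul]

/-- **Stability bound** `U(R) ≥ −φ(0) N_R / 2` for every finite configuration ("In the theorem
below `φ̂ ≥ 0` implies `U(R) ≥ −φ(0)N_R/2`, hence, stability"): Fourier positivity with all
charges `+1`. [cite: SutoPRL2005, Definitions and notations (before THEOREM)]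
[cite: BlancLewin2015, §1.3 (the `V̂₂ ≥ 0` computation)] -/
theorem neg_half_mul_le_energy (hψ : IsAdmissible κ ψ) {N : ℕ}
    (R : Fin N → EuclideanSpace ℝ (Fin d)) :
    -((N : ℝ) / 2 * potential ψ 0) ≤ energy (potential ψ) R := by
  have hQ := sum_sum_mul_potential_nonneg hψ (fun _ : Fin N => (1 : ℝ)) R
  simp only [one_mul] at hQ
  rw [energy_eq_half_sum_sub]
  linarith

/-! ### Density and the local energy per particle of the family -/

/-- The density `ρ(F + G) = #F / covol(G)` of a periodic configuration. [cite: Suto2006, §2] -/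
def density (P : PeriodicConfiguration d) : ℝ :=
  (P.motif.card : ℝ) / ZLattice.covolume P.lattice

/-- **The energy of one particle of the family in the field of all the others**: for admissible
`(κ, ψ)` and a finite disjoint union `X = ⋃_j P_j` of periodic configurations satisfying the
reciprocal-lattice condition, at EVERY point `x ∈ X`,
`∑_{y ∈ X, y ≠ x} φ(x − y) = ρ(X) φ̂(0) − φ(0)` with `ρ(X) = ∑_j ρ(P_j)` — the force-free field
`U(r|X) = ρ(X)φ̂(0)` of the source minus the self-term; hence the energy per particle of `X` is
`½[ρ(X)φ̂(0) − φ(0)] = ε(ρ)/ρ`, the same at every site. [cite: SutoPRL2005, THEOREM (i) and end of its proof (U(r|X) = ρ(X)φ̂(0))]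
[cite: Suto2006, §2 THEOREM (i) (ε(ρ) = ½ρ[ρφ̂(0) − φ(0)])] -/
theorem hasSum_potential_iUnion_diff_singleton (hψ : IsAdmissible κ ψ) {J : ℕ}
    (P : Fin J → PeriodicConfiguration d) (hP : ∀ j, DualVectorsAtLeast κ (P j).lattice)
    (hdisj : Pairwise fun i j => Disjoint (P i).points (P j).points)
    {x : EuclideanSpace ℝ (Fin d)} (hx : x ∈ ⋃ j, (P j).points) :
    HasSum (fun y : ↥((⋃ j, (P j).points) \ {x}) => potential ψ (x - y))
      (ψ 0 * ∑ j, density (P j) - potential ψ 0) := by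
  set X : Set (EuclideanSpace ℝ (Fin d)) := ⋃ j, (P j).points with hX
  have hfield := hasSum_potential_iUnion hψ P hP hdisj x
  have hc : ∑ j, ((P j).motif.card * (ψ 0 / ZLattice.covolume (P j).lattice)) =
      ψ 0 * ∑ j, density (P j) := by
    rw [Finset.mul_sum]
    refine Finset.sum_congr rfl fun j _ => ?_
    rw [density]
    ring
  rw [hc] at hfield
  -- the singleton `{x}` as the range of a `Fin 1`-indexed configuration
  set xf : Fin 1 → EuclideanSpace ℝ (Fin d) := fun _ => x with hxf
  have hinj : Function.Injective xf := fun a b _ => Subsingleton.elim a b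
  have hrange : Set.range xf = {x} := by
    rw [hxf, Set.range_const]
  have hS : Set.range xf ⊆ X := by
    rw [hrange, Set.singleton_subset_iff]
    exact hx
  have h1 : HasSum (fun y : Set.range xf => potential ψ (x - y)) (potential ψ 0) := by
    have := (hinj.hasSum_range_iff (f := fun z => potential ψ (x - z))).mpr (hasSum_fintype _)
    simpa [hxf] using this
  have h2 : Summable (fun y : ↥(X \ Set.range xf) => potential ψ (x - y)) :=
    hfield.summable.comp_injective (i := Set.inclusion Set.sdiff_subset)
      (Set.inclusion_injective (Set.sdiff_subset : X \ Set.range xf ⊆ X))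
  have h3 := HasSum.add_disjoint (f := fun z => potential ψ (x - z)) Set.disjoint_sdiff_left
    h2.hasSum h1
  rw [Set.sdiff_union_of_subset hS] at h3
  have h4 := hfield.unique h3
  have h5 : ∑' y : ↥(X \ Set.range xf), potential ψ (x - y) =
      ψ 0 * ∑ j, density (P j) - potential ψ 0 := by linarith
  rw [hrange] at h2 h5
  rw [← h5]
  exact h2.hasSum


/-! ### Non-vacuity: two certified members of the class

`IsAdmissible κ ψ` is inhabited by `ψ = 0` (the zero interaction, for which every configuration
is trivially a GSC). Two genuine members, both radial and with Schwartz-class `φ`: the smooth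
plateau `ψ₁(w) = σ(2 − ‖w‖²/R²)` (`σ` = Mathlib's `Real.smoothTransition`; `ψ₁ = 1` on
`‖w‖ ≤ R`, `= 0` on `‖w‖ ≥ √2 R`; `φ̂₁(0) = ψ₁(0) = 1 > 0`: SUPERSTABLE) and the annular profile
`ψ₀(w) = ‖w‖² ψ₁(w)` (`ψ₀(0) = 0`, `ψ₀ ≢ 0`: `∫ φ₀ = 0`, stable but NOT superstable — the case
"even if `φ̂(0) = 0` and thus `φ` is not superstable" [cite: Suto2006, §2 Remark 4]). Strong
temperedness: `φ = Re 𝓕⁻ψ` with `ψ` smooth of compact support, so `𝓕⁻ψ` is a Schwartz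
function and `|φ(r)| ≤ C(1 + ‖r‖)^{-(d+1)} ≤ C‖r‖^{-(d+1)}` ("we can obtain fast-decaying (but not
finite-range) interactions satisfying the conditions of the theorem … This `φ̂` is infinitely
differentiable. By inverse-Fourier transforming it we find `φ` to decay faster than
algebraically" [cite: SutoPRL2005, Examples]). -/

section Inhabitants

open Literature.Analysis.Distribution

variable (d)

/-- The smooth plateau profile `ψ₁(w) = σ(2 − ‖w‖²/R²)` on `ℝᵈ` (real-valued; its complex
coercion is the tree's `Literature.Analysis.Distribution.plateau R`). [folklore] -/
def plateauProfile (R : ℝ) (w : EuclideanSpace ℝ (Fin d)) : ℝ :=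
  Real.smoothTransition (2 - ‖w‖ ^ 2 / R ^ 2)

/-- The annular profile `ψ₀(w) = ‖w‖² σ(2 − ‖w‖²/R²)`, vanishing at the origin. [folklore] -/
def annulusProfile (R : ℝ) (w : EuclideanSpace ℝ (Fin d)) : ℝ :=
  ‖w‖ ^ 2 * plateauProfile d R w

variable {d}

/-- `ψ₁(0) = 1` (so `φ̂₁(0) > 0`: superstable). [folklore] -/
theorem plateauProfile_zero (R : ℝ) : plateauProfile d R 0 = 1 := by
  simp [plateauProfile, Real.smoothTransition.one_of_one_le]

/-- `ψ₀(0) = 0` (so `φ̂₀(0) = 0`: not superstable). [folklore] -/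
theorem annulusProfile_zero (R : ℝ) : annulusProfile d R 0 = 0 := by
  simp [annulusProfile]

/-- `ψ₀(w) = ‖w‖² > 0` on the punctured ball `0 < ‖w‖ ≤ R` (so `ψ₀ ≢ 0` as soon as `d ≥ 1`).
[folklore] -/
theorem annulusProfile_eq_norm_sq {R : ℝ} (hR : 0 < R) {w : EuclideanSpace ℝ (Fin d)}
    (hw : ‖w‖ ≤ R) : annulusProfile d R w = ‖w‖ ^ 2 := by
  have h1 : ‖w‖ ^ 2 / R ^ 2 ≤ 1 := by
    rw [div_le_one (by positivity)]
    exact pow_le_pow_left₀ (norm_nonneg _) hw 2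
  rw [annulusProfile, plateauProfile, Real.smoothTransition.one_of_one_le (by linarith), mul_one]

/-- The complex coercion of `ψ₁` is the tree's `plateau R`. [folklore] -/
theorem coe_plateauProfile (R : ℝ) :
    (fun w : EuclideanSpace ℝ (Fin d) => (plateauProfile d R w : ℂ)) = plateau R := rfl

/-- `ψ₁` vanishes for `‖w‖ ≥ √2 R`, in particular for `‖w‖ > 2R` when `R > 0`. [folklore] -/
theorem plateauProfile_eq_zero {R : ℝ} (hR : 0 < R) {w : EuclideanSpace ℝ (Fin d)}
    (hw : 2 * R < ‖w‖) : plateauProfile d R w = 0 := by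
  have h := plateau_eq_zero (V := EuclideanSpace ℝ (Fin d)) hR hw.le
  have h' : ((plateauProfile d R w : ℝ) : ℂ) = 0 := h
  exact_mod_cast h'

/-- **Strong temperedness of `Re 𝓕⁻Ψ` for a Schwartz function `Ψ`**: `|Re 𝓕⁻Ψ(r)| ≤ C‖r‖^{-(d+1)}`
for `‖r‖ > 1`. [folklore] -/
theorem isStronglyTempered_re_fourierInv (Ψ : SchwartzMap (EuclideanSpace ℝ (Fin d)) ℂ) :
    IsStronglyTempered (fun r : EuclideanSpace ℝ (Fin d) => ((𝓕⁻ (⇑Ψ)) r).re) := by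
  obtain ⟨C, hC0, hC⟩ := exists_norm_le_one_add_norm_pow_neg (𝓕⁻ Ψ) (d + 1)
  refine ⟨C + 1, 1, 1, by linarith, one_pos, one_pos, fun r hr => ?_⟩
  have hr0 : 0 < ‖r‖ := lt_trans one_pos hr
  have h1 : |((𝓕⁻ (⇑Ψ)) r).re| ≤ ‖(𝓕⁻ (⇑Ψ)) r‖ := Complex.abs_re_le_norm _
  have h2 : ‖(𝓕⁻ (⇑Ψ)) r‖ ≤ C * (1 + ‖r‖) ^ (-((d + 1 : ℕ) : ℝ)) := by
    have := hC r
    rwa [SchwartzMap.fourierInv_coe] at this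
  have h3 : (1 + ‖r‖) ^ (-((d + 1 : ℕ) : ℝ)) ≤ ‖r‖ ^ (-((d : ℝ) + 1)) := by
    have : (-((d + 1 : ℕ) : ℝ)) = -((d : ℝ) + 1) := by push_cast; ring
    rw [this]
    have hd : (0 : ℝ) ≤ d := Nat.cast_nonneg d
    exact Real.rpow_le_rpow_of_nonpos hr0 (by linarith) (by linarith)
  have h4 : 0 ≤ ‖r‖ ^ (-((d : ℝ) + 1)) := Real.rpow_nonneg hr0.le _
  calc |((𝓕⁻ (⇑Ψ)) r).re| ≤ C * (1 + ‖r‖) ^ (-((d + 1 : ℕ) : ℝ)) := h1.trans h2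
    _ ≤ C * ‖r‖ ^ (-((d : ℝ) + 1)) := mul_le_mul_of_nonneg_left h3 hC0
    _ ≤ (C + 1) * ‖r‖ ^ (-((d : ℝ) + 1)) := by nlinarith

/-- **`ψ₁` is admissible with cut-off `2R`** (continuous, `≥ 0`, even, band-limited, and
`φ₁ = Re 𝓕⁻ψ₁` strongly tempered, `𝓕⁻ψ₁` being a Schwartz function).
[cite: SutoPRL2005, Examples] [cite: Suto2006, §2 Remark 6] -/
theorem isAdmissible_plateauProfile {R : ℝ} (hR : 0 < R) :
    IsAdmissible (2 * R) (plateauProfile d R) where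
  pos := by positivity
  continuous := Real.smoothTransition.continuous.comp
    (continuous_const.sub ((continuous_norm.pow 2).div_const _))
  nonneg w := Real.smoothTransition.nonneg _
  even w := by simp [plateauProfile, norm_neg]
  eq_zero w hw := plateauProfile_eq_zero hR hw
  tempered := by
    have h : potential (plateauProfile d R) =
        fun r => ((𝓕⁻ (⇑(plateauSchwartz (V := EuclideanSpace ℝ (Fin d)) hR))) r).re := by
      funext r
      rw [potential, coe_plateauProfile]
      rfl
    rw [h]
    exact isStronglyTempered_re_fourierInv _

/-- `ψ₀` has compact support. [folklore] -/
theorem hasCompactSupport_coe_annulusProfile {R : ℝ} (hR : 0 < R) :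
    HasCompactSupport (fun w : EuclideanSpace ℝ (Fin d) => (annulusProfile d R w : ℂ)) := by
  have h : (fun w : EuclideanSpace ℝ (Fin d) => (annulusProfile d R w : ℂ)) =
      (fun w : EuclideanSpace ℝ (Fin d) => ((‖w‖ ^ 2 : ℝ) : ℂ)) * plateau R := by
    funext w
    simp only [annulusProfile, Pi.mul_apply, Complex.ofReal_mul]
    rfl
  rw [h]
  exact (hasCompactSupport_plateau hR).mul_left

/-- `ψ₀` is smooth. [folklore] -/
theorem contDiff_coe_annulusProfile (R : ℝ) :
    ContDiff ℝ (⊤ : ℕ∞) (fun w : EuclideanSpace ℝ (Fin d) => (annulusProfile d R w : ℂ)) := by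
  have h : (fun w : EuclideanSpace ℝ (Fin d) => (annulusProfile d R w : ℂ)) =
      fun w => ((‖w‖ ^ 2 : ℝ) : ℂ) * plateau R w := by
    funext w
    simp only [annulusProfile, Complex.ofReal_mul]
    rfl
  rw [h]
  exact (Complex.ofRealCLM.contDiff.comp (contDiff_norm_sq ℝ)).mul (contDiff_plateau R)

/-- `ψ₀` as a Schwartz function. [folklore] -/
def annulusSchwartz {R : ℝ} (hR : 0 < R) : SchwartzMap (EuclideanSpace ℝ (Fin d)) ℂ :=
  (hasCompactSupport_coe_annulusProfile (d := d) hR).toSchwartzMap (contDiff_coe_annulusProfile R)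

/-- **`ψ₀` is admissible with cut-off `2R`**: a stable, NOT superstable member (`ψ₀(0) = 0`).
[cite: Suto2006, §2 Remark 4] [cite: SutoPRL2005, Examples] -/
theorem isAdmissible_annulusProfile {R : ℝ} (hR : 0 < R) :
    IsAdmissible (2 * R) (annulusProfile d R) where
  pos := by positivity
  continuous := (continuous_norm.pow 2).mul (Real.smoothTransition.continuous.comp
    (continuous_const.sub ((continuous_norm.pow 2).div_const _)))
  nonneg w := mul_nonneg (by positivity) (Real.smoothTransition.nonneg _)
  even w := by simp [annulusProfile, plateauProfile, norm_neg]
  eq_zero w hw := by rw [annulusProfile, plateauProfile_eq_zero hR hw, mul_zero]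
  tempered := by
    have h : potential (annulusProfile d R) =
        fun r => ((𝓕⁻ (⇑(annulusSchwartz (d := d) hR))) r).re := by
      funext r
      rw [potential]
      rfl
    rw [h]
    exact isStronglyTempered_re_fourierInv _

end Inhabitants


/-- `φ₀(0) = ∫ ψ₀ > 0` for `d ≥ 1`: the energy per particle `−φ₀(0)/2` of the family is strictly
negative (a condensed zero-pressure ground state, not a dispersed gas). [folklore] -/
theorem potential_annulusProfile_zero_pos (hd : 1 ≤ d) {R : ℝ} (hR : 0 < R) :
    0 < potential (annulusProfile d R) 0 := by
  have hA := isAdmissible_annulusProfile (d := d) hR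
  rw [potential_zero]
  have hint : Integrable (annulusProfile d R) := by
    have h := (integrable_coe hA.continuous hA.eq_zero).re
    simpa using h
  rw [integral_pos_iff_support_of_nonneg hA.nonneg hint]
  -- the support is open (continuity) and contains the point `R e₀`
  have hopen : IsOpen (Function.support (annulusProfile d R)) :=
    hA.continuous.isOpen_support
  set k : Fin d := ⟨0, hd⟩
  set w₀ : EuclideanSpace ℝ (Fin d) := EuclideanSpace.single k R with hw₀
  have hnorm : ‖w₀‖ = R := by
    rw [hw₀]
    simp [abs_of_pos hR]
  have hmem : w₀ ∈ Function.support (annulusProfile d R) := by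
    rw [Function.mem_support, annulusProfile_eq_norm_sq hR hnorm.le, hnorm]
    positivity
  exact hopen.measure_pos volume ⟨w₀, hmem⟩

end Suto

open Suto

/-! ### The narrowed entry -/

/-- **Sütő's degenerate ground states — what the degeneracy does and does not block
(barrier audit 2026-08-15, narrowing `SutoDegenerateGroundStates`).** For `d ≥ 1` and every
admissible `(κ, ψ)` (`Suto.IsAdmissible`; `φ = Re 𝓕⁻ψ`, `φ̂(0) = ψ(0)`, `φ(0) = ∫ψ`):

(1) STABILITY BOUND: `U(R) ≥ −N_R φ(0)/2` for every finite configuration `R` ("`φ̂ ≥ 0` implies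
`U(R) ≥ −φ(0)N_R/2`, hence, stability" [cite: SutoPRL2005, Definitions and notations (before THEOREM)]) — so
`−φ(0)/2` bounds from below the energy per particle of everything, in particular
`E(N)/N ≥ −φ(0)/2` for the zero-pressure problem of `Crystallization`
[cite: BlancLewin2015, §1.3 ((8) and the `V̂₂ ≥ 0` computation)];

(2) THE FAMILY (parent entry, a theorem: `SutoDegenerateGroundStates_holds`): every finite
disjoint union `X = ⋃_j P_j` of periodic configurations whose lattices satisfy `q_{B_j^*} ≥ K₀`
is a GSC [cite: Suto2006, §2 THEOREM (i)], AND at every site `x ∈ X`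
`∑_{y ∈ X, y ≠ x} φ(x − y) = ρ(X)φ̂(0) − φ(0)`, `ρ(X) = ∑_j #F_j/covol(B_j)`: the field of `X` is
force-free, `U(r|X) = ρ(X)φ̂(0)` [cite: SutoPRL2005, THEOREM (i) and end of its proof], so the
energy per particle of `X` is `½[ρ(X)φ̂(0) − φ(0)] = ε(ρ)/ρ`
[cite: Suto2006, §2 THEOREM (i) (ε(ρ) = ½ρ[ρφ̂(0) − φ(0)])] — an AFFINE, non-decreasing function
of the density alone, STRICTLY increasing iff `φ̂(0) > 0` (superstable
[cite: SutoPRL2005, after THEOREM ("superstable if φ̂(0) > 0")]), constant `≡ −φ(0)/2` = the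
bound (1) iff `φ̂(0) = 0` [cite: Suto2006, §2 Remark 4].

BARRIER (D-0021), AtomisticToContinuum/Crystallization — every clause a citation or a clause of
the typed statement:
* technique_class: gsc-uniqueness-at-prescribed-density gsc-periodicity-at-prescribed-density grand-canonical-gsc-uniqueness-at-prescribed-mu zero-pressure-uniqueness-for-stable-not-superstable-soft-potentials fourier-positive-band-limited-pair-potential bounded-entire-pair-potential — derivations, from hypotheses met by some admissible `(κ, ψ)` with `ψ ≢ 0` (two certified members: `isAdmissible_plateauProfile`, `φ̂(0) = 1`; `isAdmissible_annulusProfile`, `φ̂(0) = 0`, `φ(0) > 0`), of UNIQUENESS up to isometry or LATTICE-PERIODICITY of infinite-volume ground state configurations taken (a) at PRESCRIBED density `ρ > ρ_d` (canonical GSC) or prescribed chemical potential `μ > μ_d = ρ_dφ̂(0) − φ(0)/2` (`μ`GSC, `ρ(μ) = [μ + φ(0)/2]/φ̂(0)` [cite: SutoPRL2005, THEOREM (iii)]), (b) at ZERO CHEMICAL POTENTIAL ("globally stable" = `μ`GSC at `μ = 0`, density `φ(0)/2φ̂(0)` [cite: Suto2006, §2 Remark 5]) when `φ(0)/2φ̂(0)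 > ρ_d`, or (c) at ZERO PRESSURE (minimal energy per particle, the `E(N)` problem) for potentials that are stable but NOT superstable (`φ̂(0) = 0`)
* blocks: (a) "For `ρ > ρ_d` the GSC is non-unique and the degeneracy is continuous" [cite: SutoPRL2005, abstract]: at every prescribed `ρ > ρ_d` a continuum of non-isometric Bravais lattices (`ρ_bcc = ρ₃ < ρ_fcc = 1.089ρ₃ < ρ_sh = √(3/2)ρ₃ < ρ_sc = √2ρ₃`, "all the high-symmetry Bravais lattices appear as GSCs between `ρ₃` and `2ρ₃`" [cite: Suto2006, §2 Remark 2]); lattice-periodicity fails from `2ρ_d` on by the theorem itself ("the simplest aperiodic GSCs, unions of two incommensurate Bravais lattices, appear only if `ρ ≥ 2ρ_d`" [cite: Suto2006, §2 Remark 2]) and already below `2ρ_d` by stacking lower-dimensional admissible lattices and sliding them independently (Stealthy Stacking Theorem: "stacked-slider phases … are nonperiodic, statistically anisotropic structures"; in `d = 3` "the simple cubic lattice allows the sliding motion of each two-dimensional square-lattice layer and the sliding motion of each line of particles inside every layer for `χ` up to `0.6981`", i.e. from `ρ_sc = √2ρ₃` on, and rows of spacing `2π/K₀` through a triangular lattice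 of `q = K₀`, slid along themselves, give `χ = (8/9)χ_P χ_Q = 0.806`, i.e. `ρ_sh = √(3/2)ρ₃` — our evaluation of their formula [cite: ZhangStillingerTorquato2015, §1 and §4 (theorem, the `χ` formula for `K_P = K_Q`, the `d = 3` examples)]; printed for periodic boxes — in infinite volume the fibrewise Poisson summation gives the same force-free field; not formalised here); (b) "φ(0)/2φ̂(0) > ρ₃, so this interaction has a continuous family of inequivalent `μ`GSC at `μ = 0`" [cite: SutoPRL2005, Examples]; (c) for `φ̂(0) = 0` every member of the family, at every density `≥ ρ_d` (aperiodic unions at `≥ 2ρ_d` included), has energy per particle `−φ(0)/2 =` the universal bound (1): all of them are zero-pressure ground states of one stable, smooth (`φ` entire), Schwartz-decaying, radial pair potential (`annulusProfile`) — so "ground states of STABLE smooth fast-decaying pair interactions in `ℝ³` are essentially unique" fails even at zero pressure, through this edge of the class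
* because: clauses (1)–(2) (proved: `sutoDegenerateGroundStatesNarrow_holds`); Fourier positivity `∑_{a,b} c_a c_b φ(p_a − p_b) = ∫ψ|∑_a c_a e^{2πi⟨v,p_a⟩}|² ≥ 0` (`Suto.sum_sum_mul_potential_nonneg`) with all `c_a = 1` gives (1); Poisson summation makes each admissible lattice's field the constant `φ̂(0)ρ(B)` (`Suto.hasSum_potential_lattice`, "This implies that the union of GSCs is also a GSC that can be aperiodic" [cite: SutoPRL2005, end of proof of (i)]), whence (2) by removing the self-term; `site energy = ½[ρφ̂(0) − φ(0)]` is strictly increasing in `ρ` for `φ̂(0) > 0` (`siteEnergy_lt_siteEnergy`) and `≡ −φ(0)/2` for `φ̂(0) = 0` (`siteEnergy_eq_neg_half`)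
* evasions_known: (i) ZERO PRESSURE + SUPERSTABILITY (`φ̂(0) > 0`, automatic for Lennard-Jones-type cores, `∫V = +∞`): on the family the energy per particle is strictly increasing in `ρ`, so NO degenerate member (`ρ > ρ_d`) minimises it — not even against the other members; the family's unique energy-per-particle minimiser sits at the threshold `ρ_d`, where `q_{B^*} = K₀` holds "for a unique Bravais lattice `B`, and this is the unique periodic GSC; in particular, `ρ₃ = K₀³/8√2π³` and the lattice is the bcc one" [cite: Suto2006, §2 Remark 2] [cite: SutoPRL2005, THEOREM (ii)] (triangular for `d = 2`, `ℤ/ρ₁` for `d = 1`); below `ρ_d` the theorem is "not predictive" [cite: SutoPRL2005, introduction] ("This linear relation breaks down for small densities … a nonanalyticity, presumably at `ρ_d`" [cite: SutoPRL2005, after THEOREM]) — the zero-pressure ground state of a superstable Sütő potential is bcc at `ρ₃` or an unknown configuration of lower density, and the theorem supplies no degenerate competitor either way; consistently, the crystallization review never cites these results and records that "no generic class of potentials has been identified, for which crystallization can be proved" [cite: BlancLewin2015, §2.1]; (ii) ENERGY VALUES are never missed: `ε(ρ)` "is the minimum of the energy density among unions of periodic configurations of density `ρ`" and is attained by a Bravais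 lattice at every `ρ ≥ ρ_d` [cite: Suto2006, §2 THEOREM (i)–(ii)], so statements of the form "the ground-state energy equals the minimum over periodic configurations" (`HasPeriodicGroundStateEnergy`-type) are untouched — only "EVERY ground state is periodic / unique" is blocked; (iii) the parent's evasions (repulsive core making fcc unique at `ρ = √2/r₀³` [cite: Suto2006, §2 THEOREM (iii) and Remark 7]; uniqueness at `ρ_d` [cite: SutoPRL2005, THEOREM (ii)]; leaving the class for localized / hard-core-like potentials [cite: FlatleyTheil2015, §1 and Theorem 1.1]) stand; (iv) Fourier transform positive on a neighbourhood of infinity (non-compact support, e.g. Gaussian core): no lattice has all its non-zero dual vectors in the zero set of `φ̂`, the force-free mechanism is unavailable, and at high density "for interactions having a strictly positive Fourier transform the distribution of particles tends to be uniform", the Lebesgue measure being the only infinite-density ground state "if `v > 0`" [cite: Suto2011, abstract and section "Infinite-density ground state in infinite space" (paragraph after Conjecture 1)]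
* scope_caveats: (a) typed and PROVED here: (1), (2) for finite disjoint unions of the tree's periodic configurations, the monotonicity / constancy corollaries, and non-vacuity of the class (`plateauProfile`, `annulusProfile`, any `d`, Schwartz decay via `HasCompactSupport.toSchwartzMap`); (b) CITED, not typed: that `ε(ρ)` is minimal among all configurations of density `ρ` and the identification of the threshold lattice (bcc / triangular / `ℤ`) [cite: SutoPRL2005, THEOREM (i)–(ii)], the `μ`GSC clauses [cite: SutoPRL2005, THEOREM (iii)] [cite: Suto2006, §2 Remarks 4–5], stacked-slider GSCs [cite: ZhangStillingerTorquato2015, §4], and `lim E(N)/N ≤ ½[ρ_dφ̂(0) − φ(0)]` (chunks of bcc; standard); (c) "zero-pressure ground state" is used for an infinite configuration whose energy per particle equals `inf_R U(R)/N_R`; for `φ̂(0) = 0` clause (1)+(2) certify this for every member of the family, for `φ̂(0) > 0` nothing here identifies the infimum; (d) the finite-`N` minimisers `E(N)` of a Sütő potential and their local limits (`IsCrystallizing`) are not determined by any of the cited results — the barrier concerns infinite-volume notions, as in the parent's caveat (a); (e) Lennard-Jones itself is outside the class (parent caveat (b)); (f) the parent's technique_class phrase "hypotheses … that hold throughout `Suto.IsAdmissible`"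 must be read "met by some non-zero admissible `ψ`": `ψ = 0` is admissible and no crystallization hypothesis holds for the zero interaction
* status: established — parent discharged (`SutoDegenerateGroundStates_holds`), this entry proved (`sutoDegenerateGroundStatesNarrow_holds`, axioms `propext`, `Classical.choice`, `Quot.sound`); sources re-read at page level: [cite: SutoPRL2005, pp. 1–5 of arXiv:math-ph/0508004] [cite: Suto2006, §2 pp. 5–8 and §3.3 of arXiv:math-ph/0608041] [cite: Suto2011, abstract; sections "Ground state configurations in infinite space" (Lemma 10) and "Infinite-density ground state in infinite space" (Conjecture 1)] [cite: ZhangStillingerTorquato2015, §1, §4] [cite: BlancLewin2015, §1.3, §2.1]; no dissent found (searches: citing works of Sütő 2005 (57, OpenAlex graph), "stealthy hyperuniform ground states stacked-slider", Bétermin–Petrache 2019, galaxy `--star all` "crystalline ground states")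

[cite: Suto2006, §2 THEOREM (i) and Remarks 2, 4, 5] [cite: SutoPRL2005, THEOREM (i)–(iii)] -/
def SutoDegenerateGroundStatesNarrow : Prop :=
  ∀ (d : ℕ), 1 ≤ d → ∀ (κ : ℝ) (ψ : EuclideanSpace ℝ (Fin d) → ℝ), IsAdmissible κ ψ →
    (∀ (N : ℕ) (R : Fin N → EuclideanSpace ℝ (Fin d)),
        -((N : ℝ) / 2 * potential ψ 0) ≤ energy (potential ψ) R) ∧
    ∀ (J : ℕ) (P : Fin J → Literature.MathematicalPhysics.StatisticalMechanics.PeriodicConfiguration d),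
      (∀ j, DualVectorsAtLeast κ (P j).lattice) →
      Pairwise (fun i j => Disjoint (P i).points (P j).points) →
      IsGSC (potential ψ) (⋃ j, (P j).points) ∧
      ∀ x ∈ ⋃ j, (P j).points,
        HasSum (fun y : ↥((⋃ j, (P j).points) \ {x}) => potential ψ (x - y))
          (ψ 0 * ∑ j, density (P j) - potential ψ 0)

/-- PROOF of the narrowed entry: (1) `Suto.neg_half_mul_le_energy`; (2) the parent theorem
`SutoDegenerateGroundStates_holds` and `Suto.hasSum_potential_iUnion_diff_singleton`.
[cite: Suto2006, §2 THEOREM (i)] [cite: SutoPRL2005, THEOREM (i)] -/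
theorem sutoDegenerateGroundStatesNarrow_holds : SutoDegenerateGroundStatesNarrow := by
  intro d hd κ ψ hψ
  refine ⟨fun N R => neg_half_mul_le_energy hψ R, fun J P hP hdisj => ⟨?_, fun x hx => ?_⟩⟩
  · exact SutoDegenerateGroundStates_holds d hd κ ψ hψ J P hP hdisj
  · exact hasSum_potential_iUnion_diff_singleton hψ P hP hdisj hx

/-! ### Corollaries: the energy per particle on the family -/

namespace Suto

variable {d : ℕ} {κ : ℝ} {ψ : EuclideanSpace ℝ (Fin d) → ℝ}

/-- The **site energy** `e(X, x) = ½ ∑_{y ∈ X, y ≠ x} φ(x − y)` of the particle at `x` in the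
configuration `X` (half its interaction with all the others; for the family it is the energy per
particle `ε(ρ)/ρ`, the same at every site). [cite: Suto2006, §2 (U(R|X)) and THEOREM (i)] -/
def siteEnergy (φ : EuclideanSpace ℝ (Fin d) → ℝ) (X : Set (EuclideanSpace ℝ (Fin d)))
    (x : EuclideanSpace ℝ (Fin d)) : ℝ :=
  1 / 2 * ∑' y : ↥(X \ {x}), φ (x - y)

/-- **Energy per particle of the family `= ½[ρφ̂(0) − φ(0)]`** at every site.
[cite: Suto2006, §2 THEOREM (i)] [cite: SutoPRL2005, THEOREM (i)] -/
theorem siteEnergy_eq (hψ : IsAdmissible κ ψ) {J : ℕ} (P : Fin J → PeriodicConfiguration d)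
    (hP : ∀ j, DualVectorsAtLeast κ (P j).lattice)
    (hdisj : Pairwise fun i j => Disjoint (P i).points (P j).points)
    {x : EuclideanSpace ℝ (Fin d)} (hx : x ∈ ⋃ j, (P j).points) :
    siteEnergy (potential ψ) (⋃ j, (P j).points) x =
      1 / 2 * (ψ 0 * ∑ j, density (P j) - potential ψ 0) := by
  rw [siteEnergy, (hasSum_potential_iUnion_diff_singleton hψ P hP hdisj hx).tsum_eq]

/-- **Zero pressure, superstable case: the degeneracy is invisible.** If `φ̂(0) = ψ(0) > 0`, the
energy per particle is STRICTLY increasing in the density across the family: a member of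
smaller density has strictly smaller energy per particle at every site. Hence no member of
density `> ρ_d` minimises the energy per particle, even among the members; the minimum over the
family is at the threshold density, where the member is a single lattice, unique up to isometry
(bcc for `d = 3`). [cite: Suto2006, §2 THEOREM (i) and Remark 2] [cite: SutoPRL2005, THEOREM (ii)] -/
theorem siteEnergy_lt_siteEnergy (hψ : IsAdmissible κ ψ) (h0 : 0 < ψ 0) {J J' : ℕ}
    {P : Fin J → PeriodicConfiguration d} {P' : Fin J' → PeriodicConfiguration d}
    (hP : ∀ j, DualVectorsAtLeast κ (P j).lattice)
    (hdisj : Pairwise fun i j => Disjoint (P i).points (P j).points)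
    (hP' : ∀ j, DualVectorsAtLeast κ (P' j).lattice)
    (hdisj' : Pairwise fun i j => Disjoint (P' i).points (P' j).points)
    (hρ : ∑ j, density (P j) < ∑ j, density (P' j))
    {x x' : EuclideanSpace ℝ (Fin d)} (hx : x ∈ ⋃ j, (P j).points) (hx' : x' ∈ ⋃ j, (P' j).points) :
    siteEnergy (potential ψ) (⋃ j, (P j).points) x <
      siteEnergy (potential ψ) (⋃ j, (P' j).points) x' := by
  rw [siteEnergy_eq hψ P hP hdisj hx, siteEnergy_eq hψ P' hP' hdisj' hx']
  have := mul_lt_mul_of_pos_left hρ h0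
  linarith

/-- **Zero pressure, non-superstable edge: total degeneracy.** If `φ̂(0) = ψ(0) = 0`, every member
of the family — every density `≥ ρ_d`, aperiodic unions included — has energy per particle
`−φ(0)/2` at every site, which by clause (1) no finite configuration undercuts:
`N · e(X, x) ≤ U(R)` for all `R` with `N_R = N`. [cite: Suto2006, §2 Remark 4]
[cite: SutoPRL2005, Definitions and notations (U(R) ≥ −φ(0)N_R/2)] -/
theorem siteEnergy_eq_neg_half (hψ : IsAdmissible κ ψ) (h0 : ψ 0 = 0) {J : ℕ}
    (P : Fin J → PeriodicConfiguration d) (hP : ∀ j, DualVectorsAtLeast κ (P j).lattice)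
    (hdisj : Pairwise fun i j => Disjoint (P i).points (P j).points)
    {x : EuclideanSpace ℝ (Fin d)} (hx : x ∈ ⋃ j, (P j).points) :
    siteEnergy (potential ψ) (⋃ j, (P j).points) x = -(potential ψ 0 / 2) ∧
      ∀ (N : ℕ) (R : Fin N → EuclideanSpace ℝ (Fin d)),
        N * siteEnergy (potential ψ) (⋃ j, (P j).points) x ≤ energy (potential ψ) R := by
  have he : siteEnergy (potential ψ) (⋃ j, (P j).points) x = -(potential ψ 0 / 2) := by
    rw [siteEnergy_eq hψ P hP hdisj hx, h0]
    ring
  refine ⟨he, fun N R => ?_⟩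
  rw [he]
  have := neg_half_mul_le_energy hψ R
  linarith

/-- In every dimension `d ≥ 1` the non-superstable edge is inhabited by a potential whose family
has strictly NEGATIVE energy per particle `−φ₀(0)/2 < 0` (`annulusProfile`: `ψ₀(0) = 0`,
`φ₀(0) = ∫ψ₀ > 0`): its zero-pressure ground states form a condensed, continuously degenerate
family. [cite: Suto2006, §2 Remark 4] -/
theorem exists_admissible_not_superstable (hd : 1 ≤ d) :
    ∃ (κ : ℝ) (ψ : EuclideanSpace ℝ (Fin d) → ℝ),
      IsAdmissible κ ψ ∧ ψ 0 = 0 ∧ 0 < potential ψ 0 :=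
  ⟨2 * 1, annulusProfile d 1, isAdmissible_annulusProfile one_pos, annulusProfile_zero 1,
    potential_annulusProfile_zero_pos hd one_pos⟩

/-- … and the superstable interior by one with `φ̂₁(0) = ψ₁(0) = 1 > 0` (`plateauProfile`).
[cite: SutoPRL2005, Examples] -/
theorem exists_admissible_superstable :
    ∃ (κ : ℝ) (ψ : EuclideanSpace ℝ (Fin d) → ℝ), IsAdmissible κ ψ ∧ 0 < ψ 0 :=
  ⟨2 * 1, plateauProfile d 1, isAdmissible_plateauProfile one_pos, by
    rw [plateauProfile_zero]; exact one_pos⟩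

end Suto

end Literature.Barriers.AtomisticToContinuum

end
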